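import Mathlib
import Summits.ResolutionOfSingularities.ResolutionOfSingularities.Theorems.WeightedInvariantLocalWeightedDropNCResRegimeTransport
import Summits.ResolutionOfSingularities.ResolutionOfSingularities.Theorems.WeightedInvariantLocalWeightedDropTOT2E1Step

/-!
# `LocalWeightedDrop`, TOT2-LINE inner S-ASM (3b): DIRECTRIX TRANSPORT AND THE LETTER-REGIME READ-OUT for the point move in ANY legal
# letter-straightening coordinates (the moves of a presented state are played in the presenting coordinates `Θ`)

Crux item stmt-ResolutionOfSingularities-8899 `WeightedInvariant.LocalWeightedDrop` (route `ResolutionOfSingularities/WeightedInvariant`), ENGINE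
skeleton v33 (35b29332b4d99231), registered stubs `stub_regimeLetter` (L) / `stub_regimePresented` (P); TOT2-LINE v1.3 §3 (L)
(`L/res-L1-w43-lead-1/g5/TOT2-LINE-v1.3.md`, lead-1 CYCLE REPORT #1 17:0xZ).  [OURS · L1 W4.3 · chain w43 · seat res-L1-w43-lead-1 gen 5; def-free;
part (3) (`…NCResRegimeTransport`, identity move) redone for a B-permissible POINT move `(Φ, 𝟙)`: the dirform of `Φ^* f` is `(lin Φ)ᵀ ℓ`
(res-type-056's `TOT2E1.initEval_subst_legal`), a straightened letter `x_l = u · x_{l′}` transports `e_l` to `u(0) · e_{l′}`; the near-point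
machinery is res-L1-w43-stub-3's, on res-L1-w43-stub-1's S-SET transform.  Nothing here is a statement of any manuscript; AI-produced, gate-checked,
weaker than expert review.]

* `not_hCol_of_isDirForm` — (three letters) a directrix form has two independent vectors in its kernel: `IsDirForm ⇒ ¬ HCol`;
* `initEval_substF_of_isDirForm` — the degree-`c` form of `Φ^* f` is `λ·((ℓ ᵥ* M)·v)^c`, `M = lin Φ`;
* `vecMul_ne_zero_of_isUnit_det` — `ℓ ᵥ* M ≠ 0` for `ℓ ≠ 0`, `det M` a unit;
* `row_linMat_of_straight` — a straightened letter: `Φ l = u · X l′ ⇒ (M l j) = u(0)·[j = l′]`, so `e_l ᵥ* M = u(0) · e_{l′}`;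
* **`Decoration.tail_dirForm_transform_legal`** — at a same-order answer `(c, i)` of the B-permissible point move `(Φ, 𝟙)` from a state with empty
  history and dirform `ℓ`, every dirform `L` of the transform has tail proportional to the transported `ℓ ᵥ* M`;
* `Decoration.vecMul_dot_eq_zero_of_near` — `(ℓ ᵥ* M) · c = 0` at such an answer;
* **`Decoration.letterDir_or_badDir_transform_legal`**, **`Decoration.letter_exit_legal`** — (L)-exit through `Φ`: from `LetterDir δ l` the transform is
  `LetterDir` for the re-indexed straightened letter (when the new dirform has no `s`-component) or `BadDir`; three-letter form with the apex column.
-/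

set_option linter.dupNamespace false -- mandated namespace of this single-conjunct summit

noncomputable section

namespace Summit.ResolutionOfSingularities.ResolutionOfSingularities.Theorems

open Literature.AlgebraicGeometry.Resolution

namespace TameFourTupleDrop

open MvPowerSeries TOT2Near

variable {k : Type} [Field k] {m : ℕ}

namespace Decoration

/-! ## A directrix form is outside the apex column (three letters) -/

/-- **`IsDirForm ⇒ ¬ HCol`** (three letters): the kernel of a non-zero linear form on `k³` contains two linearly independent vectors, both invariance
vectors of the degree-`c` form `λ·(ℓ·v)^c`. -/
theorem not_hCol_of_isDirForm {δ : Decoration k 2} {ℓ : Fin (2 + 1) → k} (hℓ : δ.IsDirForm ℓ) : ¬ δ.HCol := by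
  intro hcol
  have hℓ0 : ℓ ≠ 0 := hℓ.1
  -- two kernel vectors built from a non-zero coordinate of `ℓ`
  obtain ⟨a, ha⟩ : ∃ a, ℓ a ≠ 0 := by
    by_contra hall; push Not at hall; exact hℓ0 (funext hall)
  -- the two other indices
  obtain ⟨b, hb⟩ : ∃ b : Fin (2 + 1), b ≠ a := ⟨a + 1, by
    intro h; have := congrArg Fin.val h; simp [Fin.val_add] at this; omega⟩
  obtain ⟨c', hc'a, hc'b⟩ : ∃ c' : Fin (2 + 1), c' ≠ a ∧ c' ≠ b := by
    have : ∀ x y : Fin 3, ∃ z : Fin 3, z ≠ x ∧ z ≠ y := by decide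
    exact this a b
  -- `v₁ = ℓ_a e_b − ℓ_b e_a`, `v₂ = ℓ_a e_c − ℓ_c e_a`
  set v₁ : Fin (2 + 1) → k := Pi.single b (ℓ a) - Pi.single a (ℓ b) with hv₁
  set v₂ : Fin (2 + 1) → k := Pi.single c' (ℓ a) - Pi.single a (ℓ c') with hv₂
  have hk₁ : dotProduct ℓ v₁ = 0 := by
    rw [hv₁, dotProduct_sub, dotProduct_single, dotProduct_single]; ring
  have hk₂ : dotProduct ℓ v₂ = 0 := by
    rw [hv₂, dotProduct_sub, dotProduct_single, dotProduct_single]; ring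
  obtain ⟨α, β, hαβ, hrel⟩ := hcol v₁ v₂ (isInv_of_isDirForm hℓ hk₁) (isInv_of_isDirForm hℓ hk₂)
  -- read the relation at the coordinates `b` and `c'`
  have hb' := congr_fun hrel b
  have hc'' := congr_fun hrel c'
  simp only [hv₁, hv₂, Pi.add_apply, Pi.smul_apply, Pi.sub_apply, Pi.single_eq_same, Pi.single_eq_of_ne hb, Pi.single_eq_of_ne hc'b.symm,
    Pi.single_eq_of_ne hc'b, Pi.single_eq_of_ne hc'a, smul_eq_mul, Pi.zero_apply, sub_zero, mul_zero, add_zero,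
    zero_add] at hb' hc''
  rcases hαβ with hα | hβ
  · exact hα ((mul_eq_zero.mp hb').resolve_right ha)
  · exact hβ ((mul_eq_zero.mp hc'').resolve_right ha)

/-! ## The dirform of `Φ^* f` and of straightened letters -/

variable {b : MvPowerSeries (Fin (m + 1)) k} {δ : Decoration k m} {Φ : Fin (m + 1) → MvPowerSeries (Fin (m + 1)) k}
  {c : Fin (m + 1) → k} {i : Fin (m + 1)}

/-- **THE DEGREE-`c` FORM OF `Φ^* f`** for a state with empty history and dirform `ℓ`: `λ · ((ℓ ᵥ* M) · v)^c` with `M = lin Φ`. -/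
theorem initEval_substF_of_isDirForm (hadm : Admissible b δ) (hO : δ.O = ∅) {ℓ : Fin (m + 1) → k} (hℓ : δ.IsDirForm ℓ)
    (hmv : IsCountMove Φ (fun _ => 1)) :
    ∃ la : k, la ≠ 0 ∧ ∀ v : Fin (m + 1) → k, CobordantChart.initEval (fun _ : Fin (m + 1) => 1) v δ.o (subst Φ δ.f) =
      la * dotProduct (Matrix.vecMul ℓ (Matrix.of fun a j : Fin (m + 1) => coeff (Finsupp.single j 1) (Φ a))) v ^ δ.o := by
  obtain ⟨-, la, hla, hcone⟩ := hℓ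
  rw [c_eq_o_of_O_eq_empty hO, totalO_eq_f_of_O_eq_empty hO] at hcone
  have hf : δ.f ≠ 0 := hadm.2.1.ne_zero
  have hford : δ.f.order = δ.o := by
    have hfin : δ.f.order ≠ ⊤ := by rw [ne_eq, order_eq_top_iff]; exact hf
    rw [Decoration.o, ENat.coe_toNat hfin]
  refine ⟨la, hla, fun v => ?_⟩
  rw [TOT2E1.initEval_subst_legal Φ hmv.1 hmv.2.1 δ.f hford v, hcone, Matrix.dotProduct_mulVec]

/-- `ℓ ᵥ* M ≠ 0` for `ℓ ≠ 0` and `det M` a unit. -/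
theorem vecMul_ne_zero_of_isUnit_det {n : ℕ} {M : Matrix (Fin n) (Fin n) k} (hM : IsUnit M.det) {ℓ : Fin n → k} (hℓ : ℓ ≠ 0) :
    Matrix.vecMul ℓ M ≠ 0 := by
  intro h0
  apply hℓ
  have h := congrArg (fun w => Matrix.vecMul w M⁻¹) h0
  simp only [Matrix.vecMul_vecMul, Matrix.mul_nonsing_inv _ hM, Matrix.vecMul_one, Matrix.zero_vecMul] at h
  exact h

/-- **A STRAIGHTENED LETTER'S ROW**: `Φ l = u · X l′` gives `(lin Φ) l j = u(0) · [j = l′]`. -/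
theorem row_linMat_of_straight {l l' : Fin (m + 1)} {u : MvPowerSeries (Fin (m + 1)) k} (he : Φ l = u * X l') (j : Fin (m + 1)) :
    coeff (Finsupp.single j 1) (Φ l) = constantCoeff u * (if j = l' then 1 else 0) := by
  classical
  rw [he, mul_comm, X, coeff_monomial_mul]
  · -- `X l′ = monomial (single l′ 1) 1`
    by_cases hj : j = l'
    · subst hj
      rw [if_pos le_rfl, if_pos rfl, tsub_self, coeff_zero_eq_constantCoeff_apply, one_mul, mul_one]
    · rw [if_neg, if_neg hj, mul_zero]
      intro hle
      have := hle l'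
      rw [Finsupp.single_eq_same, Finsupp.single_eq_of_ne (Ne.symm hj)] at this
      omega

/-- Hence `e_l ᵥ* M = u(0) · e_{l′}` for a straightened letter. -/
theorem vecMul_single_of_straight {l l' : Fin (m + 1)} {u : MvPowerSeries (Fin (m + 1)) k} (he : Φ l = u * X l') :
    Matrix.vecMul (Pi.single l 1) (Matrix.of fun a j : Fin (m + 1) => coeff (Finsupp.single j 1) (Φ a)) =
      constantCoeff u • Pi.single l' 1 := by
  funext j
  rw [Matrix.single_one_vecMul]
  change coeff (Finsupp.single j 1) (Φ l) = _
  rw [row_linMat_of_straight he j, Pi.smul_apply, smul_eq_mul, Pi.single_apply]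

/-! ## Directrix transport under a B-permissible point move in the coordinates `Φ` -/

/-- The near-data package at a same-order answer of the point move `(Φ, 𝟙)`. -/
theorem nearData_point (hadm : Admissible b δ) (hperm : IsBPermissible δ Φ (fun _ => 1)) (hci : c i ≠ 0)
    (heq : (δ.transform Φ (fun _ => 1) c i).o = δ.o) :
    subst (CobordantChart.chart (fun _ : Fin (m + 1) => 1) c) (subst Φ δ.f) = X 0 ^ δ.o * satPart (δ.fChart Φ (fun _ => 1) c) ∧
      ((δ.o : ℕ) : ℕ∞) ≤ (TupleGame.slice i (satPart (δ.fChart Φ (fun _ => 1) c))).order ∧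
      (δ.transform Φ (fun _ => 1) c i).f = TupleGame.slice i (satPart (δ.fChart Φ (fun _ => 1) c)) := by
  have hf : δ.f ≠ 0 := hadm.2.1.ne_zero
  have hc0 : ∀ l : Fin (m + 1), (fun _ : Fin (m + 1) => (1 : ℕ)) l = 0 → c l = 0 := fun l hl => absurd hl one_ne_zero
  obtain ⟨hfac, -, hnear⟩ := Decoration.nearData_of_o_transform_eq hperm hc0 hf hci heq
  exact ⟨hfac, hnear, Decoration.transform_f_eq_strict_of_o_transform_eq hperm hc0 hf hci heq⟩

/-- **`(ℓ ᵥ* M) · c = 0` AT A SAME-ORDER ANSWER** of the point move `(Φ, 𝟙)` from a state with empty history and dirform `ℓ`. -/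
theorem vecMul_dot_eq_zero_of_near [Infinite k] (hadm : Admissible b δ) (ho : 2 ≤ δ.o) (hO : δ.O = ∅) {ℓ : Fin (m + 1) → k}
    (hℓ : δ.IsDirForm ℓ) (hperm : IsBPermissible δ Φ (fun _ => 1)) (hci : c i ≠ 0)
    (heq : (δ.transform Φ (fun _ => 1) c i).o = δ.o) :
    dotProduct (Matrix.vecMul ℓ (Matrix.of fun a j : Fin (m + 1) => coeff (Finsupp.single j 1) (Φ a))) c = 0 := by
  obtain ⟨la, hla, hcone⟩ := initEval_substF_of_isDirForm hadm hO hℓ hperm.1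
  have hf : δ.f ≠ 0 := hadm.2.1.ne_zero
  have hc0 : ∀ l : Fin (m + 1), (fun _ : Fin (m + 1) => (1 : ℕ)) l = 0 → c l = 0 := fun l hl => absurd hl one_ne_zero
  set L := Matrix.vecMul ℓ (Matrix.of fun a j : Fin (m + 1) => coeff (Finsupp.single j 1) (Φ a)) with hL
  have hL0 : L ≠ 0 := vecMul_ne_zero_of_isUnit_det hperm.1.2.1 hℓ.1
  refine eq_zero_of_pow_add_eq (o := δ.o) hla (by omega) fun a => ?_
  obtain ⟨j₁, hj₁⟩ : ∃ j₁, L j₁ ≠ 0 := by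
    by_contra hall; push Not at hall; exact hL0 (funext hall)
  have hv : dotProduct L (Pi.single j₁ (a / L j₁)) = a := by rw [dotProduct_single, mul_div_cancel₀ _ hj₁]
  have h1 := Decoration.inv_of_near hperm hc0 hf hci heq 1 (Pi.single j₁ (a / L j₁))
  rw [one_smul, hcone, hcone, dotProduct_add, hv] at h1
  exact h1

/-- **DIRECTRIX TRANSPORT THROUGH `Φ`.**  From an admissible state with `2 ≤ o`, empty history and dirform `ℓ`, at an answer `(c, i)` of the
B-permissible point move `(Φ, 𝟙)` with the same order, every dirform `L` of the transform has tail proportional (non-zero factor) to the transported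
`ℓ ᵥ* M`: `(ℓ ᵥ* M) (i.succAbove j) = κ · L j.succ`. -/
theorem tail_dirForm_transform_legal [Infinite k] (hadm : Admissible b δ) (ho : 2 ≤ δ.o) (hO : δ.O = ∅) {ℓ : Fin (m + 1) → k}
    (hℓ : δ.IsDirForm ℓ) (hperm : IsBPermissible δ Φ (fun _ => 1)) (hci : c i ≠ 0)
    (heq : (δ.transform Φ (fun _ => 1) c i).o = δ.o) {L : Fin (m + 1) → k}
    (hL : (δ.transform Φ (fun _ => 1) c i).IsDirForm L) :
    ∃ κ : k, κ ≠ 0 ∧ ∀ j : Fin m,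
      Matrix.vecMul ℓ (Matrix.of fun a j : Fin (m + 1) => coeff (Finsupp.single j 1) (Φ a)) (i.succAbove j) = κ * L j.succ := by
  cases m with
  | zero => exact ⟨1, one_ne_zero, fun j => j.elim0⟩
  | succ n =>
    obtain ⟨hfac, hnear, hf'⟩ := nearData_point hadm hperm hci heq
    obtain ⟨la, hla, hcone⟩ := initEval_substF_of_isDirForm hadm hO hℓ hperm.1
    have hL0 := vecMul_ne_zero_of_isUnit_det hperm.1.2.1 hℓ.1
    obtain ⟨-, la', -, hcone'⟩ := hL
    rw [c_eq_o_of_O_eq_empty (transform_O_eq_empty hO heq), totalO_eq_f_of_O_eq_empty (transform_O_eq_empty hO heq), heq, hf']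
      at hcone'
    exact tail_dirForm_of_near (subst Φ δ.f) c i hci (by omega) hfac hnear hL0 hla hcone hcone'

/-! ## The boundary of the transform under a letter-straightening move -/

/-- The boundary letters of the transform under `(Φ, 𝟙)`: `0` and the re-indexed straightened letters passing through the new point. -/
theorem mem_transform_E_point_iff (l' : Fin (m + 1)) :
    l' ∈ (δ.transform Φ (fun _ => 1) c i).E ↔ l' = 0 ∨ ∃ l ∈ δ.E, c (strIdx Φ l) = 0 ∧ Fin.predAbove i (strIdx Φ l).succ = l' := by
  classical
  rw [Decoration.transform_E, Finset.mem_insert]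
  unfold newLetters
  simp only [Finset.mem_image, Finset.mem_filter]
  constructor
  · rintro (h | ⟨l, ⟨hl, hc⟩, he⟩)
    · exact Or.inl h
    · exact Or.inr ⟨l, hl, hc, he⟩
  · rintro (h | ⟨l, hl, hc, he⟩)
    · exact Or.inl h
    · exact Or.inr ⟨l, ⟨hl, hc⟩, he⟩

/-- The new exceptional letter `0` is a boundary letter of the transform. -/
theorem zero_mem_transform_E_point : (0 : Fin (m + 1)) ∈ (δ.transform Φ (fun _ => 1) c i).E :=
  (mem_transform_E_point_iff 0).mpr (Or.inl rfl)

/-- At an answer with live slot `i`, `j.succ` is a boundary letter of the transform iff `i.succAbove j` is the straightened index of a boundary letter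
passing through the new point. -/
theorem succ_mem_transform_E_point_iff (hci : c i ≠ 0) (j : Fin m) :
    (j.succ : Fin (m + 1)) ∈ (δ.transform Φ (fun _ => 1) c i).E ↔
      ∃ l ∈ δ.E, strIdx Φ l = i.succAbove j ∧ c (i.succAbove j) = 0 := by
  rw [mem_transform_E_point_iff]
  constructor
  · rintro (h | ⟨l, hl, hc, he⟩)
    · exact absurd h (Fin.succ_ne_zero j)
    · rcases Fin.eq_self_or_eq_succAbove i (strIdx Φ l) with hli | ⟨j', hj'⟩
      · rw [hli] at hc; exact absurd hc hci
      · rw [hj', TOT2Near.predAbove_succ_succAbove_succ] at he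
        cases Fin.succ_injective _ he
        exact ⟨l, hl, hj', hj' ▸ hc⟩
  · rintro ⟨l, hl, hj, hc⟩
    exact Or.inr ⟨l, hl, hj ▸ hc, by rw [hj, TOT2Near.predAbove_succ_succAbove_succ]⟩

/-! ## The letter-regime read-out through `Φ` -/

/-- **(L-EXIT) THROUGH `Φ`.**  From an admissible state with `2 ≤ o` in the letter regime `LetterDir δ l`, at an answer `(c, i)` of the B-permissible
point move `(Φ, 𝟙)` (every boundary letter straightened by `Φ`) with the same order, if the transform has a dirform `L` then either `L 0 = 0` and the
transform is in the letter regime for the re-indexed straightened letter, or `L 0 ≠ 0` and the transform is in BAD position. -/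
theorem letterDir_or_badDir_transform_legal [Infinite k] (hadm : Admissible b δ) (ho : 2 ≤ δ.o) {l : Fin (m + 1)} (hl : δ.LetterDir l)
    (hperm : IsBPermissible δ Φ (fun _ => 1)) (hci : c i ≠ 0) (heq : (δ.transform Φ (fun _ => 1) c i).o = δ.o)
    {L : Fin (m + 1) → k} (hL : (δ.transform Φ (fun _ => 1) c i).IsDirForm L) :
    (∃ l'', (δ.transform Φ (fun _ => 1) c i).LetterDir l'') ∨ (δ.transform Φ (fun _ => 1) c i).BadDir := by
  classical
  obtain ⟨hO, hlE, hdir⟩ := hl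
  set δ' := δ.transform Φ (fun _ => 1) c i with hδ'
  have hO' : δ'.O = ∅ := transform_O_eq_empty hO heq
  -- the straightened letter `x_{l′}`: `Φ l = u · X l′`, `e_l ᵥ* M = u(0) · e_{l′}`
  obtain ⟨u, hu, he⟩ := strIdx_spec (hperm.2.2.2 l hlE)
  set l' := strIdx Φ l with hl'
  set M := (Matrix.of fun a j : Fin (m + 1) => coeff (Finsupp.single j 1) (Φ a)) with hM
  have hrow : Matrix.vecMul (Pi.single l 1) M = constantCoeff u • Pi.single l' 1 := vecMul_single_of_straight he
  -- `c_{l′} = 0`: the letter passes through the new point; hence `l′ ≠ i`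
  have hcl' : c l' = 0 := by
    have h := vecMul_dot_eq_zero_of_near hadm ho hO hdir hperm hci heq
    rw [← hM, hrow, smul_dotProduct, single_one_dotProduct, smul_eq_mul] at h
    exact (mul_eq_zero.mp h).resolve_left hu
  have hli : l' ≠ i := fun h => hci (h ▸ hcl')
  obtain ⟨j₀, hj₀⟩ := Fin.exists_succAbove_eq hli
  -- the tail of `L` is the transported `e_{l′}`
  obtain ⟨κ, hκ, htail⟩ := tail_dirForm_transform_legal hadm ho hO hdir hperm hci heq hL
  have htail' : ∀ j : Fin m, constantCoeff u * (Pi.single l' (1 : k) : Fin (m + 1) → k) (i.succAbove j) = κ * L j.succ := by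
    intro j
    have h := htail j
    rw [← hM, hrow, Pi.smul_apply, smul_eq_mul] at h
    exact h
  have hLj₀ : L j₀.succ ≠ 0 := by
    have h := htail' j₀
    rw [hj₀, Pi.single_eq_same, mul_one] at h
    intro h0
    rw [h0, mul_zero] at h
    exact hu h
  have hLj : ∀ j, j ≠ j₀ → L j.succ = 0 := by
    intro j hj
    have h := htail' j
    rw [Pi.single_eq_of_ne (fun h' => hj (Fin.succAbove_right_injective (h'.trans hj₀.symm))), mul_zero, eq_comm, mul_eq_zero] at h
    exact h.resolve_left hκ
  have hmem : (j₀.succ : Fin (m + 1)) ∈ δ'.E := (succ_mem_transform_E_point_iff hci j₀).mpr ⟨l, hlE, hj₀.symm, hj₀ ▸ hcl'⟩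
  by_cases hL0 : L 0 = 0
  · left
    refine ⟨j₀.succ, hO', hmem, isDirForm_single_of_support hL fun j' hj' => ?_⟩
    refine Fin.cases (fun _ => hL0) (fun j hj => ?_) j' hj'
    exact hLj j fun h => hj (by rw [h])
  · right
    refine ⟨hO', L, hL, fun j' hj' => ?_, 0, j₀.succ, (Fin.succ_ne_zero j₀).symm, hL0, hLj₀⟩
    refine Fin.cases (fun _ => zero_mem_transform_E_point) (fun j hj => ?_) j' hj'
    by_cases hjj : j = j₀
    · rw [hjj]; exact hmem
    · exact absurd (hLj j hjj) hj

/-- **(L-EXIT) THROUGH `Φ`, THREE LETTERS**: the transform at a same-order answer, if admissibly decorating the successor, is in the apex column, or in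
the letter regime, or in bad position. -/
theorem letter_exit_legal [Infinite k] {b : MvPowerSeries (Fin (2 + 1)) k} {δ : Decoration k 2}
    {Φ : Fin (2 + 1) → MvPowerSeries (Fin (2 + 1)) k} {c : Fin (2 + 1) → k} {i : Fin (2 + 1)}
    (hadm : Admissible b δ) (ho : 2 ≤ δ.o) {l : Fin (2 + 1)} (hl : δ.LetterDir l) (hperm : IsBPermissible δ Φ (fun _ => 1)) (hci : c i ≠ 0)
    (heq : (δ.transform Φ (fun _ => 1) c i).o = δ.o) {b' : MvPowerSeries (Fin (2 + 1)) k}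
    (hadm' : Admissible b' (δ.transform Φ (fun _ => 1) c i)) :
    (δ.transform Φ (fun _ => 1) c i).HCol ∨ (∃ l'', (δ.transform Φ (fun _ => 1) c i).LetterDir l'') ∨ (δ.transform Φ (fun _ => 1) c i).BadDir := by
  by_cases hc' : (δ.transform Φ (fun _ => 1) c i).HCol
  · exact Or.inl hc'
  · obtain ⟨L, hL⟩ := exists_isDirForm_of_not_hCol hadm' (heq ▸ ho) hc'
    exact Or.inr (letterDir_or_badDir_transform_legal hadm ho hl hperm hci heq hL)

end Decoration

end TameFourTupleDrop

end Summit.ResolutionOfSingularities.ResolutionOfSingularities.Theorems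

end
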